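import Summits.CriticalPhenomena.PercolationContinuityZ3.Theses.PercShatteringRace
import Summits.CriticalPhenomena.PercolationContinuityZ3.Theses.PercAnnulusCrossing
import Summits.CriticalPhenomena.PercolationContinuityZ3.Theorems.PercShatteringRaceNearLinearTwoClusterDecaySplit
import Summits.CriticalPhenomena.PercolationContinuityZ3.Theorems.PercShatteringRaceNearLinearTwoClusterDecayPairDecayNullWorld
import Summits.CriticalPhenomena.PercolationContinuityZ3.Theorems.PercShatteringRaceNearLinearTwoClusterDecayChildTwoNullWorld
import Summits.CriticalPhenomena.PercolationContinuityZ3.Theorems.PercShatteringRaceNearLinearTwoClusterDecayChildTwoJumpWorld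
import Summits.CriticalPhenomena.PercolationContinuityZ3.Theorems.PercShatteringRaceNearLinearTwoClusterDecayOfShellNonCertainty
import Summits.CriticalPhenomena.PercolationContinuityZ3.Theorems.PercLowPointHalfSpaceQuantitativeBGNOfAnnulusCrossing
import Summits.CriticalPhenomena.PercolationContinuityZ3.Theorems.NearLinearTwoClusterDecay.Negative.Structure
import Summits.CriticalPhenomena.PercolationContinuityZ3.Theorems.NearLinearTwoClusterDecay.Negative.Dichotomy
import Summits.CriticalPhenomena.PercolationContinuityZ3.Theorems.NearLinearTwoClusterDecay.Negative.BoundedAspect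
import Summits.CriticalPhenomena.PercolationContinuityZ3.Theorems.PercShatteringRaceRaceLemma
import HarnessLib

/-!
# ClosureR1 — crux-strategist r1 (REDIRECT second opinion) certificate for
# `PercShatteringRace.NearLinearTwoClusterDecay` = U(1/6) (stmt-CriticalPhenomena-5785)

Evidence file of planner-cstrat-stmt-CriticalPhenomena-5785-r1-0 (2026-08-17); companion of
`STRATEGY-CENSUS-r1.md`.  Everything here elaborates against the tree; nothing is `sorry`.

§1 CLOSURE CERTIFICATE (all by name from landed theorems).  Writing `S := PercolationContinuityZ3`
(`θ(p_c) = 0`), `P := PairTwoArmsDecay` (child 1), `L := LongArmsAreDense` (child 2),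
`XB := PercAnnulusCrossing.CritAnnulusNonCrossing` (stmt-0846), `CD(α) := Negative.CrossingDecay α`:
  * `U ⇐ P ∧ L` (`crux_of_children`), `U ⇒ P` (`child1_of_crux`), `0<θ ⇒ (U ↔ P ∧ L)` (`crux_iff_children_jump`);
  * `S ⇒ P` (`child1_of_summit`): child 1 is summit-IMPLIED (its open content is the jump world only);
  * `S ⇒ (L ↔ CD(7/6))` (`child2_iff_crossingDecay_of_summit`), `CD(7/6) ⇒ L` (`child2_of_crossingDecay`,
    proved here: containment), `CD(7/6) ⇒ U` (`crux_of_crossingDecay`), `CD(7/6) ⇒ S`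
    (`summit_of_crossingDecay`): the θ=0 residue of U, in its one-arm form, IS the summit mechanism;
  * `XB ⇒ U` (`crux_of_XB`) and `XB ⇒ S` (`summit_of_XB`, proved here from the landed polynomial crossing
    decay): the only live sufficient condition for U's residue on the ledger is summit-strength
    (tribunal T1 pattern "dominating hypothesis H ⇒ C with H ⇒ S alone");
  * `S(1/2) ∧ P ⇒ S` (`route_closes_via_child1`): the RE-TARGET of route PercShatteringRace.
§2 NEW (proved): the route tolerates the PAIR × FREQUENTLY form of U.  `raceLemma_of_jumpBoxLRO_frequently`
   (the consumed race with in-box LRO only along SOME sequence of scales) and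
   `percolationContinuityZ3_of_powerSaving_of_pairFrequently` (`S(1/2) ∧ PairFrequently ⇒ S`), where
   `PairFrequently := ∀ ε>0, ∃ᶠ n, ∀ x x' ∈ Λ_n, P_{p_c}(pairBad ⌈n^{7/6}⌉ x x') ≤ ε` (= liminf form of child 1).
   So U as filed is over-strength in THREE independent ways (union vs pair; unguarded; eventually vs
   frequently) — none of which changes the difficulty class (census §2), all of which a tenure restate may use.
§3 NEW (typed; corollaries proved): `PolyGluedCriterion` = van den Berg–van Engelenburg's same-p glued
   finite-size criterion (tree: `Negative.gluedCriterion`, bounded aspect) at POLYNOMIAL aspect 7/6, with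
   blocks spaced at the OUTER radius and uniqueness chained along segments of `≍ n^{1/6}` small boxes, so the
   loss is the polynomial factor `L(n) ≍ n^{1/6}` instead of vdBvE's `ε(M) = δ^{(32M+1)²}`; its consequence at
   `p_c` (`critPolyDichotomy_of_polyGluedCriterion`, proved here by continuity in `p` exactly as
   `Negative.twoCluster_dichotomy`): for all `n ≥ 2`,
   `ε₀ ≤ L(n) · (P_{p_c}(Λ_{n/2} ↮ ∂ⁱⁿΛ_{2m} in Λ_{2m}) + P_{p_c}(U's event at n))`, `m = ⌈n^{7/6}⌉`; and in a
   jump world the first probability is at most the VOID probability `P(no x ∈ Λ_{n/2} percolates)`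
   (`critPolyDichotomy_voids`).  Reading: any proof of U with rate `o(n^{-1/6})` certifies, unconditionally,
   polynomial-aspect crossing non-certainty `≳ n^{-1/6}`, and in every jump world void frequency `≳ n^{-1/6}`.
   The criterion itself (≈ 500 Lean lines on top of `DependentStarPercolation` / `GluingCriterion`) is left
   to the standing disprover as a `Negative/` item; it is NOT a line on U (census §4).
-/

noncomputable section

namespace Summit.CriticalPhenomena.PercolationContinuityZ3.Cruxes.NearLinearTwoClusterDecay.StrategistR1

open MeasureTheory Filter Topology
open Literature.Probability.LatticeModels Literature.Probability.Percolation
open Summit.CriticalPhenomena.PercolationContinuityZ3.Theses.PercShatteringRace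
open Summit.CriticalPhenomena.PercolationContinuityZ3.Theorems
open Summit.CriticalPhenomena.PercolationContinuityZ3.Theorems.NearLinearTwoClusterDecaySplit

/-! ## §0 The statements (verbatim route / children wording) -/

/-- Child 1 = `PairTwoArmsDecay` (children.json on the item; = `Stubs.stub_pairDecayJumpWorld`'s target). -/
def Child1 : Prop :=
  ∀ ε : ℝ, 0 < ε → ∀ᶠ n : ℕ in Filter.atTop, ∀ x ∈ box 3 n, ∀ x' ∈ box 3 n,
    (bondPercolation (zdGraph 3) (criticalProbI 3)).real
      {ω | ∃ y ∈ innerBoundary (zdGraph 3) (box 3 ⌈(n : ℝ) ^ ((7 : ℝ) / 6)⌉₊),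
        ∃ y' ∈ innerBoundary (zdGraph 3) (box 3 ⌈(n : ℝ) ^ ((7 : ℝ) / 6)⌉₊),
          ω ∈ openConnIn ↑(box 3 ⌈(n : ℝ) ^ ((7 : ℝ) / 6)⌉₊) x y ∧
          ω ∈ openConnIn ↑(box 3 ⌈(n : ℝ) ^ ((7 : ℝ) / 6)⌉₊) x' y' ∧
          ω ∉ openConnIn ↑(box 3 ⌈(n : ℝ) ^ ((7 : ℝ) / 6)⌉₊) x x'} ≤ ε

/-- Child 2 = `LongArmsAreDense`. -/
def Child2 : Prop :=
  ∀ ε : ℝ, 0 < ε → ∃ κ : ℝ, 0 < κ ∧ ∀ᶠ n : ℕ in Filter.atTop,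
    (bondPercolation (zdGraph 3) (criticalProbI 3)).real
      {ω | ∃ x ∈ box 3 n,
        (∃ y ∈ innerBoundary (zdGraph 3) (box 3 ⌈(n : ℝ) ^ ((7 : ℝ) / 6)⌉₊),
          ω ∈ openConnIn ↑(box 3 ⌈(n : ℝ) ^ ((7 : ℝ) / 6)⌉₊) x y) ∧
        (Set.ncard {z : Site 3 | z ∈ box 3 n ∧
            ω ∈ openConnIn ↑(box 3 ⌈(n : ℝ) ^ ((7 : ℝ) / 6)⌉₊) x z} : ℝ) < κ * (box 3 n).card} ≤ ε

/-- In-box crossing decay at aspect `7/6` in the route wording (the one-arm form of the residue). -/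
def CrossTendsto76 : Prop :=
  Filter.Tendsto (fun n : ℕ => (bondPercolation (zdGraph 3) (criticalProbI 3)).real
    {ω | ∃ x ∈ box 3 n, ∃ y ∈ innerBoundary (zdGraph 3) (box 3 ⌈(n : ℝ) ^ ((7 : ℝ) / 6)⌉₊),
      ω ∈ openConnIn ↑(box 3 ⌈(n : ℝ) ^ ((7 : ℝ) / 6)⌉₊) x y}) Filter.atTop (nhds 0)

/-- The route wording of crossing decay at `7/6` is `Negative.CrossingDecay (7/6)` (definitional). -/
theorem crossTendsto76_iff : CrossTendsto76 ↔ NearLinearTwoClusterDecay.Negative.CrossingDecay ((7 : ℝ) / 6) :=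
  Iff.rfl

/-! ## §1 Closure certificate (by name) -/

/-- `U ⇐ P ∧ L` — the split glue (landed p137625). -/
theorem crux_of_children (h₁ : Child1) (h₂ : Child2) : NearLinearTwoClusterDecay :=
  nearLinearTwoClusterDecay_of_subs h₁ h₂

/-- `U ⇒ P` — necessity of child 1. -/
theorem child1_of_crux (h : NearLinearTwoClusterDecay) : Child1 :=
  pairTwoArmsDecay_of_nearLinearTwoClusterDecay h

/-- `0 < θ(p_c) ⇒ (U ↔ P ∧ L)` — the cut is lossless in the jump world. -/
theorem crux_iff_children_jump (hθ : 0 < theta (zdGraph 3) 0 (criticalProbI 3)) :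
    NearLinearTwoClusterDecay ↔ Child1 ∧ Child2 :=
  nearLinearTwoClusterDecay_iff_pair_and_longArmsAreDense_of_theta_pos hθ

/-- **`S ⇒ P`**: the summit implies child 1 (one-arm decay in the `θ(p_c) = 0` world). So child 1's
open content lives in the jump world only, and child 1 can never be refuted without refuting the summit. -/
theorem child1_of_summit (hS : _root_.PercolationContinuityZ3) : Child1 :=
  pairTwoArmsDecay_of_theta_eq_zero (percolationContinuityZ3_iff.1 hS)

/-- **`S ⇒ (L ↔ crossing decay at 7/6)`**: in the `θ(p_c)=0` world child 2 IS polynomial-aspect crossing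
decay (hyperscaling-lite). -/
theorem child2_iff_crossingDecay_of_summit (hS : _root_.PercolationContinuityZ3) :
    Child2 ↔ CrossTendsto76 :=
  longArmsAreDense_iff_crossingDecay_of_theta_eq_zero (percolationContinuityZ3_iff.1 hS)

/-- **Crossing decay at `7/6` gives child 2 outright** (the thin-arm event is contained in the crossing
event; no hypothesis on `θ`). [folklore] -/
theorem child2_of_crossingDecay (h : CrossTendsto76) : Child2 := by
  intro ε hε
  refine ⟨1, one_pos, ?_⟩
  have hev : ∀ᶠ n : ℕ in atTop, (bondPercolation (zdGraph 3) (criticalProbI 3)).real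
      {ω | ∃ x ∈ box 3 n, ∃ y ∈ innerBoundary (zdGraph 3) (box 3 ⌈(n : ℝ) ^ ((7 : ℝ) / 6)⌉₊),
        ω ∈ openConnIn ↑(box 3 ⌈(n : ℝ) ^ ((7 : ℝ) / 6)⌉₊) x y} < ε :=
    (tendsto_order.1 h).2 ε hε
  filter_upwards [hev] with n hn
  refine le_trans (measureReal_mono ?_) hn.le
  rintro ω ⟨x, hx, ⟨y, hy, hxy⟩, -⟩
  exact ⟨x, hx, y, hy, hxy⟩

/-- **Crossing decay at `7/6` gives the crux** (two distinct crossing clusters are in particular one crossing). -/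
theorem crux_of_crossingDecay (h : CrossTendsto76) : NearLinearTwoClusterDecay :=
  NearLinearTwoClusterDecay.Negative.nearLinearTwoClusterDecay_of_atExponent (α := (7 : ℝ) / 6)
    (by norm_num) le_rfl (NearLinearTwoClusterDecay.Negative.atExponent_of_crossingDecay h)

/-- **Crossing decay at `7/6` gives the summit** (one-arm: `θ(p_c) ≤ P(crossing)`; landed). -/
theorem summit_of_crossingDecay (h : CrossTendsto76) : _root_.PercolationContinuityZ3 :=
  NearLinearTwoClusterDecay.Negative.percolationContinuityZ3_of_crossingDecay (α := (7 : ℝ) / 6) h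

/-- **`XB ⇒ U`** (stmt-0846 ⇒ stmt-5785; landed inter-route edge). -/
theorem crux_of_XB (h : Summit.CriticalPhenomena.PercolationContinuityZ3.Theses.PercAnnulusCrossing.CritAnnulusNonCrossing) : NearLinearTwoClusterDecay :=
  nearLinearTwoClusterDecay_of_critAnnulusNonCrossing h

/-- **`XB ⇒ S`**: bounded-aspect crossing non-certainty gives polynomial crossing decay
(`OfAnnulusCrossing.critCrossingPolyDecay_of_critAnnulusNonCrossing`, landed), hence
`θ(p_c) ≤ P(cross(1, m)) ≤ C m^{-a} → 0`.  So the one live sufficient condition for the crux's residue on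
the ledger is summit-strength ALONE. [folklore] -/
theorem summit_of_XB (h : Summit.CriticalPhenomena.PercolationContinuityZ3.Theses.PercAnnulusCrossing.CritAnnulusNonCrossing) : _root_.PercolationContinuityZ3 := by
  obtain ⟨a, C, ha, hdec⟩ := OfAnnulusCrossing.critCrossingPolyDecay_of_critAnnulusNonCrossing h
  show theta (zdGraph 3) (0 : Site 3) (criticalProbI 3) = 0
  refine le_antisymm ?_ measureReal_nonneg
  -- `θ ≤ C (1/m)^a` for every `m ≥ 1`
  have hbound : ∀ m : ℕ, 1 ≤ m →
      theta (zdGraph 3) (0 : Site 3) (criticalProbI 3) ≤ C * ((((1 : ℕ) : ℝ)) / m) ^ a := by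
    intro m hm
    refine (NearLinearTwoClusterDecay.Negative.theta_le_real_crossingEvt 1 m).trans ?_
    exact hdec 1 m le_rfl hm
  -- the right-hand side tends to `0`
  have hlim : Tendsto (fun m : ℕ => C * ((((1 : ℕ) : ℝ)) / m) ^ a) atTop (𝓝 0) := by
    have h1 : Tendsto (fun m : ℕ => (((1 : ℕ) : ℝ)) / (m : ℝ)) atTop (𝓝 0) := by
      simpa using tendsto_const_div_atTop_nhds_zero_nat (1 : ℝ)
    have h2 : Tendsto (fun m : ℕ => ((((1 : ℕ) : ℝ)) / (m : ℝ)) ^ a) atTop (𝓝 0) := by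
      have := h1.rpow_const (p := a) (Or.inr ha.le)
      simpa [Real.zero_rpow ha.ne'] using this
    simpa using h2.const_mul C
  exact ge_of_tendsto hlim ((eventually_ge_atTop 1).mono fun m hm => hbound m hm)

/-- **The re-target**: `S(1/2) ∧ P ⇒ S` — child 1 together with the route's other crux already closes the
route (landed certificate; the tenure planner's `closes (hS) (hP) := …`). -/
theorem route_closes_via_child1 (hS : FreeSusceptibilityPowerSaving) (h₁ : Child1) :
    _root_.PercolationContinuityZ3 :=
  percolationContinuityZ3_of_powerSaving_of_pairTwoArmsDecay hS h₁

/-- **Bounded aspect is refuted** (negative boundary, landed): at every bounded aspect `M ≥ 2` the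
two-cluster probability does not tend to `0`. -/
theorem boundedAspect_refuted : ∀ M : ℕ, 2 ≤ M →
    ¬ Tendsto (fun k : ℕ => (bondPercolation (zdGraph 3) (criticalProbI 3)).real
      (NearLinearTwoClusterDecay.Negative.twoClusterEvt k (M * k))) atTop (𝓝 0) :=
  NearLinearTwoClusterDecay.Negative.not_tendsto_twoCluster_boundedAspect

/-! ## §2 NEW: the route tolerates the PAIR × FREQUENTLY form -/

/-- The consumed race with in-box LRO only FREQUENTLY in the scale: for `0 ≤ b`, `(1+b)(3-a) < 3`,
`S(a)` (all scales) and `0 < θ(p_c) → ∃ c > 0, ∃ᶠ n, ∀ y ∈ Λ_n, c ≤ P_{p_c}(0 ↔ y in Λ_{⌈n^{1+b}⌉})` give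
`θ(p_c) = 0`.  Same arithmetic as the landed `Consumed.raceLemma_of_jumpBoxLRO`; the "eventually" of the
jump-world lower bound is replaced by "frequently", which still meets the "for all R" upper bound. [folklore] -/
theorem raceLemma_of_jumpBoxLRO_frequently : ∀ a b : ℝ, 0 ≤ b → (1 + b) * (3 - a) < 3 →
    (∃ C : ℝ, ∀ R : ℕ, 1 ≤ R → ∑ y ∈ box 3 R,
      (bondPercolation (zdGraph 3) (criticalProbI 3)).real (openConnIn (↑(box 3 R) : Set (Site 3)) 0 y)
        ≤ C * (R : ℝ) ^ (3 - a)) →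
    (0 < theta (zdGraph 3) 0 (criticalProbI 3) → ∃ c : ℝ, 0 < c ∧ ∃ᶠ n : ℕ in atTop, ∀ y ∈ box 3 n,
      c ≤ (bondPercolation (zdGraph 3) (criticalProbI 3)).real
        (openConnIn (↑(box 3 ⌈(n : ℝ) ^ (1 + b)⌉₊) : Set (Site 3)) 0 y)) →
    _root_.PercolationContinuityZ3 := by
  intro a b hb hab hS hL
  show theta (zdGraph 3) (0 : Site 3) (criticalProbI 3) = 0
  by_contra hne
  have hθ : 0 < theta (zdGraph 3) (0 : Site 3) (criticalProbI 3) :=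
    lt_of_le_of_ne measureReal_nonneg (Ne.symm hne)
  set μ := bondPercolation (zdGraph 3) (criticalProbI 3)
  obtain ⟨C, hC⟩ := hS
  obtain ⟨c, hc, hfr⟩ := hL hθ
  -- the exponent race: `C R^{3-a} ≤ K n^s` with `s < 3` (verbatim from the landed proof)
  obtain ⟨K, s, hs3, hK⟩ : ∃ K s : ℝ, s < 3 ∧ ∀ n : ℕ, 1 ≤ n →
      C * ((⌈(n : ℝ) ^ (1 + b)⌉₊ : ℕ) : ℝ) ^ (3 - a) ≤ K * (n : ℝ) ^ s := by
    rcases le_or_gt (3 - a) 0 with ha | ha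
    · refine ⟨|C|, 0, by norm_num, fun n hn => ?_⟩
      have hn1 : (1 : ℝ) ≤ n := by exact_mod_cast hn
      have hR1 : (1 : ℝ) ≤ ((⌈(n : ℝ) ^ (1 + b)⌉₊ : ℕ) : ℝ) := by
        have h1 : (1 : ℝ) ≤ (n : ℝ) ^ (1 + b) := Real.one_le_rpow hn1 (by linarith)
        exact h1.trans (Nat.le_ceil _)
      have hle1 : ((⌈(n : ℝ) ^ (1 + b)⌉₊ : ℕ) : ℝ) ^ (3 - a) ≤ 1 :=
        Real.rpow_le_one_of_one_le_of_nonpos hR1 ha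
      have hnn : 0 ≤ ((⌈(n : ℝ) ^ (1 + b)⌉₊ : ℕ) : ℝ) ^ (3 - a) :=
        Real.rpow_nonneg (by positivity) _
      rw [Real.rpow_zero, mul_one]
      calc C * ((⌈(n : ℝ) ^ (1 + b)⌉₊ : ℕ) : ℝ) ^ (3 - a)
          ≤ |C| * ((⌈(n : ℝ) ^ (1 + b)⌉₊ : ℕ) : ℝ) ^ (3 - a) :=
            mul_le_mul_of_nonneg_right (le_abs_self C) hnn
        _ ≤ |C| * 1 := mul_le_mul_of_nonneg_left hle1 (abs_nonneg C)
        _ = |C| := mul_one _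
    · refine ⟨|C| * (2 : ℝ) ^ (3 - a), (1 + b) * (3 - a), hab, fun n hn => ?_⟩
      have hn1 : (1 : ℝ) ≤ n := by exact_mod_cast hn
      have hn0 : (0 : ℝ) ≤ n := by positivity
      have hpow1 : (1 : ℝ) ≤ (n : ℝ) ^ (1 + b) := Real.one_le_rpow hn1 (by linarith)
      have hpow0 : (0 : ℝ) ≤ (n : ℝ) ^ (1 + b) := zero_le_one.trans hpow1
      have hR2 : ((⌈(n : ℝ) ^ (1 + b)⌉₊ : ℕ) : ℝ) ≤ 2 * (n : ℝ) ^ (1 + b) := by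
        have := Nat.ceil_lt_add_one hpow0
        linarith
      have hR0 : (0 : ℝ) ≤ ((⌈(n : ℝ) ^ (1 + b)⌉₊ : ℕ) : ℝ) := by positivity
      have hRpow : ((⌈(n : ℝ) ^ (1 + b)⌉₊ : ℕ) : ℝ) ^ (3 - a) ≤
          (2 : ℝ) ^ (3 - a) * (n : ℝ) ^ ((1 + b) * (3 - a)) := by
        calc ((⌈(n : ℝ) ^ (1 + b)⌉₊ : ℕ) : ℝ) ^ (3 - a)
            ≤ (2 * (n : ℝ) ^ (1 + b)) ^ (3 - a) := Real.rpow_le_rpow hR0 hR2 ha.le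
          _ = (2 : ℝ) ^ (3 - a) * ((n : ℝ) ^ (1 + b)) ^ (3 - a) :=
              Real.mul_rpow (by norm_num) hpow0
          _ = (2 : ℝ) ^ (3 - a) * (n : ℝ) ^ ((1 + b) * (3 - a)) := by
              rw [← Real.rpow_mul hn0]
      have hnn : 0 ≤ ((⌈(n : ℝ) ^ (1 + b)⌉₊ : ℕ) : ℝ) ^ (3 - a) := Real.rpow_nonneg hR0 _
      calc C * ((⌈(n : ℝ) ^ (1 + b)⌉₊ : ℕ) : ℝ) ^ (3 - a)
          ≤ |C| * ((⌈(n : ℝ) ^ (1 + b)⌉₊ : ℕ) : ℝ) ^ (3 - a) :=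
            mul_le_mul_of_nonneg_right (le_abs_self C) hnn
        _ ≤ |C| * ((2 : ℝ) ^ (3 - a) * (n : ℝ) ^ ((1 + b) * (3 - a))) :=
            mul_le_mul_of_nonneg_left hRpow (abs_nonneg C)
        _ = |C| * (2 : ℝ) ^ (3 - a) * (n : ℝ) ^ ((1 + b) * (3 - a)) := by ring
  -- at every GOOD scale `n` (all `y ∈ Λ_n` have the lower bound), `(2n+1)³ c ≤ K n^s`
  have hmain : ∀ n : ℕ, 1 ≤ n →
      (∀ y ∈ box 3 n, c ≤ μ.real (openConnIn (↑(box 3 ⌈(n : ℝ) ^ (1 + b)⌉₊) : Set (Site 3)) 0 y)) →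
      (((2 * n + 1) ^ 3 : ℕ) : ℝ) * c ≤ K * (n : ℝ) ^ s := by
    intro n hn hgood
    set R : ℕ := ⌈(n : ℝ) ^ (1 + b)⌉₊
    have hnR : n ≤ R := le_nat_ceil_rpow (by linarith) n
    have hR1 : 1 ≤ R := hn.trans hnR
    have hsum : (((2 * n + 1) ^ 3 : ℕ) : ℝ) * c ≤
        ∑ y ∈ box 3 R, μ.real (openConnIn (↑(box 3 R) : Set (Site 3)) 0 y) := by
      calc (((2 * n + 1) ^ 3 : ℕ) : ℝ) * c = ∑ _y ∈ box 3 n, c := by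
            rw [Finset.sum_const, card_box, nsmul_eq_mul]
        _ ≤ ∑ y ∈ box 3 n, μ.real (openConnIn (↑(box 3 R) : Set (Site 3)) 0 y) :=
            Finset.sum_le_sum hgood
        _ ≤ ∑ y ∈ box 3 R, μ.real (openConnIn (↑(box 3 R) : Set (Site 3)) 0 y) :=
            Finset.sum_le_sum_of_subset_of_nonneg (box_mono 3 hnR)
              fun _ _ _ => measureReal_nonneg
    exact hsum.trans ((hC R hR1).trans (hK n hn))
  -- a good scale `n` which is also large: `n^{3-s} > K / c`, `n ≥ 1`
  have htend : Tendsto (fun n : ℕ => ((n : ℝ)) ^ (3 - s)) atTop atTop :=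
    (tendsto_rpow_atTop (by linarith : (0 : ℝ) < 3 - s)).comp tendsto_natCast_atTop_atTop
  obtain ⟨n, hgood, hbig, hn1⟩ :=
    (hfr.and_eventually ((htend.eventually_gt_atTop (K / c)).and (eventually_ge_atTop 1))).exists
  have hnpos : (0 : ℝ) < n := by exact_mod_cast hn1
  have hns : 0 < (n : ℝ) ^ s := Real.rpow_pos_of_pos hnpos s
  have h3 : (n : ℝ) ^ (3 : ℝ) = (n : ℝ) ^ (3 - s) * (n : ℝ) ^ s := by
    rw [← Real.rpow_add hnpos, sub_add_cancel]
  have h3' : (n : ℝ) ^ (3 : ℝ) = ((n ^ 3 : ℕ) : ℝ) := by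
    rw [show (3 : ℝ) = ((3 : ℕ) : ℝ) by norm_num, Real.rpow_natCast]
    push_cast
    rfl
  have hcube : ((n ^ 3 : ℕ) : ℝ) ≤ (((2 * n + 1) ^ 3 : ℕ) : ℝ) := by
    exact_mod_cast Nat.pow_le_pow_left (by omega : n ≤ 2 * n + 1) 3
  have hK' : K < c * (n : ℝ) ^ (3 - s) := by
    have := (div_lt_iff₀ hc).1 hbig
    linarith
  have hlt : K * (n : ℝ) ^ s < (((2 * n + 1) ^ 3 : ℕ) : ℝ) * c :=
    calc K * (n : ℝ) ^ s < (c * (n : ℝ) ^ (3 - s)) * (n : ℝ) ^ s :=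
          mul_lt_mul_of_pos_right hK' hns
      _ = ((n ^ 3 : ℕ) : ℝ) * c := by rw [← h3', h3]; ring
      _ ≤ (((2 * n + 1) ^ 3 : ℕ) : ℝ) * c := mul_le_mul_of_nonneg_right hcube hc.le
  exact absurd (hmain n hn1 hgood) (not_le.2 hlt)

/-- The PAIR × FREQUENTLY form of U(1/6) (liminf form of child 1): for every `ε > 0`, at INFINITELY MANY
scales `n`, every pair of `Λ_n` has `P_{p_c}(pairBad ⌈n^{7/6}⌉ x x') ≤ ε`. Strictly weaker than child 1
(hence than U); its `θ(p_c)=0`-world content is still automatic. -/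
def PairFrequently : Prop :=
  ∀ ε : ℝ, 0 < ε → ∃ᶠ n : ℕ in atTop, ∀ x ∈ box 3 n, ∀ x' ∈ box 3 n, Pc.real (pairBad (outer n) x x') ≤ ε

/-- Child 1 ⇒ its frequently form. -/
theorem pairFrequently_of_child1 (h : Child1) : PairFrequently := by
  intro ε hε
  have h' := (pairDecay_iff.2 h) ε hε
  exact h'.frequently

/-- **`S(1/2) ∧ PairFrequently ⇒ θ(p_c) = 0`**: the deciding theorem survives the weakening of U to the
pair × frequently form (Harris–FKG + first exits give `θ² ≤ P(0 ↔ y in Λ_R) + P(pairBad)` at each good scale,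
then `raceLemma_of_jumpBoxLRO_frequently` at `(a,b) = (1/2, 1/6)`). [folklore] -/
theorem percolationContinuityZ3_of_powerSaving_of_pairFrequently
    (hS : FreeSusceptibilityPowerSaving) (hP : PairFrequently) : _root_.PercolationContinuityZ3 := by
  have h := raceLemma_of_jumpBoxLRO_frequently (1 / 2) (1 / 6) (by norm_num) (by norm_num)
  have e1 : (3 : ℝ) - 1 / 2 = 5 / 2 := by norm_num
  rw [e1] at h
  refine h hS ?_
  intro hθ
  refine ⟨theta (zdGraph 3) 0 (criticalProbI 3) ^ 2 / 2, by positivity, ?_⟩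
  have hε : 0 < theta (zdGraph 3) 0 (criticalProbI 3) ^ 2 / 2 := by positivity
  refine (hP _ hε).mono ?_
  intro n hn y hy
  have e : (1 + 1 / 6 : ℝ) = (7 : ℝ) / 6 := by norm_num
  rw [e]
  have hle : n ≤ outer n := le_nat_ceil_rpow (by norm_num : (1 : ℝ) ≤ 7 / 6) n
  have h1 := theta_sq_le_real_openConnIn_add_real_pairBad (criticalProbI 3)
    (box_mono 3 hle (zero_mem_box 3 n)) (box_mono 3 hle hy)
  have h2 := hn 0 (zero_mem_box 3 n) y hy
  show theta (zdGraph 3) 0 (criticalProbI 3) ^ 2 / 2 ≤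
    Pc.real (openConnIn (↑(box 3 (outer n)) : Set (Site 3)) 0 y)
  linarith

/-- U as filed gives the pair × frequently form (so the weakening is one the tenure planner may file 1:1). -/
theorem pairFrequently_of_crux (h : NearLinearTwoClusterDecay) : PairFrequently :=
  pairFrequently_of_child1 (child1_of_crux h)

/-! ## §3 NEW (typed, corollaries proved): the glued finite-size criterion at POLYNOMIAL aspect -/

/-- Number of chained small-box uniqueness/liveness events per block at scale `n` (8 planar ★-directions,
segments of sup-length `m = ⌈n^{7/6}⌉` walked at step `⌊n/2⌋`): `L(n) = 8 (4m/n + 2) + 1 ≍ n^{1/6}`. -/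
def linkCount (n : ℕ) : ℕ := 8 * (4 * outer n / n + 2) + 1

/-- **PolyGluedCriterion** (to be landed by the disprover; vdBvE Lemma 6 with blocks spaced at the OUTER
radius and uniqueness chained along segments): there is an absolute `ε₀ > 0` such that for EVERY `p` and
`n ≥ 2`, if `L(n) · (P_p(Λ_{⌊n/2⌋} ↮ ∂ⁱⁿΛ_{2m} in Λ_{2m}) + P_p(two distinct clusters of Λ_m both meeting Λ_n
and ∂ⁱⁿΛ_m)) < ε₀`, `m = ⌈n^{7/6}⌉`, then `θ(p) > 0`.  (Block `z ∈ ℤ²`, centre `(m z₁, m z₂, 0)`, is good iff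
at every fine centre `w` on its 8 segments `Λ_{⌊n/2⌋}(w) ↔ ∂Λ_{2m}(w)` and U's event fails at `w`; good
blocks are 7-dependent; ★-adjacent good blocks glue by the chain; Peierls + `LSS`-free sparse product bound
as in `Negative.gluedCriterion`.)  [cite: VandenbergVanengelenburg2022, Lemma 6 and Observation 8] -/
def PolyGluedCriterion : Prop :=
  ∃ ε : ℝ, 0 < ε ∧ ∀ (p : unitInterval) (n : ℕ), 2 ≤ n →
    (linkCount n : ℝ) *
      ((bondPercolation (zdGraph 3) p).real
          {ω | ¬ ∃ x ∈ box 3 (n / 2), ∃ y ∈ innerBoundary (zdGraph 3) (box 3 (2 * outer n)),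
            ω ∈ openConnIn (↑(box 3 (2 * outer n)) : Set (Site 3)) x y} +
        (bondPercolation (zdGraph 3) p).real
          {ω | ∃ x ∈ box 3 n, ∃ x' ∈ box 3 n,
            ∃ y ∈ innerBoundary (zdGraph 3) (box 3 (outer n)), ∃ y' ∈ innerBoundary (zdGraph 3) (box 3 (outer n)),
              ω ∈ openConnIn (↑(box 3 (outer n)) : Set (Site 3)) x y ∧
              ω ∈ openConnIn (↑(box 3 (outer n)) : Set (Site 3)) x' y' ∧
              ω ∉ openConnIn (↑(box 3 (outer n)) : Set (Site 3)) x x'}) < ε →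
    0 < theta (zdGraph 3) 0 p

/-- **CritPolyDichotomy** (the consequence at `p_c`): for all `n ≥ 2`,
`ε₀ ≤ L(n) · (P_{p_c}(Λ_{⌊n/2⌋} ↮ ∂ⁱⁿΛ_{2m} in Λ_{2m}) + P_{p_c}(U's event at scale n))`. -/
def CritPolyDichotomy : Prop :=
  ∃ ε : ℝ, 0 < ε ∧ ∀ n : ℕ, 2 ≤ n →
    ε ≤ (linkCount n : ℝ) *
      ((bondPercolation (zdGraph 3) (criticalProbI 3)).real
          {ω | ¬ ∃ x ∈ box 3 (n / 2), ∃ y ∈ innerBoundary (zdGraph 3) (box 3 (2 * outer n)),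
            ω ∈ openConnIn (↑(box 3 (2 * outer n)) : Set (Site 3)) x y} +
        (bondPercolation (zdGraph 3) (criticalProbI 3)).real
          {ω | ∃ x ∈ box 3 n, ∃ x' ∈ box 3 n,
            ∃ y ∈ innerBoundary (zdGraph 3) (box 3 (outer n)), ∃ y' ∈ innerBoundary (zdGraph 3) (box 3 (outer n)),
              ω ∈ openConnIn (↑(box 3 (outer n)) : Set (Site 3)) x y ∧
              ω ∈ openConnIn (↑(box 3 (outer n)) : Set (Site 3)) x' y' ∧
              ω ∉ openConnIn (↑(box 3 (outer n)) : Set (Site 3)) x x'})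

/-- **`PolyGluedCriterion ⇒ CritPolyDichotomy`**: both events are local, so the weighted sum is continuous in
`p`; were it `< ε₀` at `p_c` it would be `< ε₀` slightly below `p_c`, forcing `θ > 0` below `p_c` — absurd.
(Verbatim the argument of `Negative.twoCluster_dichotomy`.) [folklore] -/
theorem critPolyDichotomy_of_polyGluedCriterion (hcrit : PolyGluedCriterion) : CritPolyDichotomy := by
  obtain ⟨ε, hε, hεn⟩ := hcrit
  refine ⟨ε, hε, fun n hn => ?_⟩
  by_contra hlt
  set f := fun p : unitInterval =>
    (linkCount n : ℝ) *
      ((bondPercolation (zdGraph 3) p).real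
          {ω | ¬ ∃ x ∈ box 3 (n / 2), ∃ y ∈ innerBoundary (zdGraph 3) (box 3 (2 * outer n)),
            ω ∈ openConnIn (↑(box 3 (2 * outer n)) : Set (Site 3)) x y} +
        (bondPercolation (zdGraph 3) p).real
          {ω | ∃ x ∈ box 3 n, ∃ x' ∈ box 3 n,
            ∃ y ∈ innerBoundary (zdGraph 3) (box 3 (outer n)), ∃ y' ∈ innerBoundary (zdGraph 3) (box 3 (outer n)),
              ω ∈ openConnIn (↑(box 3 (outer n)) : Set (Site 3)) x y ∧
              ω ∈ openConnIn (↑(box 3 (outer n)) : Set (Site 3)) x' y' ∧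
              ω ∉ openConnIn (↑(box 3 (outer n)) : Set (Site 3)) x x'}) with hf
  have hcont : Continuous f :=
    continuous_const.mul (NearLinearTwoClusterDecay.Negative.Dichotomy.continuous_sum (n / 2) (2 * outer n) n (outer n))
  set p₀ : unitInterval := criticalProbI 3 with hp₀
  have hlt' : f p₀ < ε := not_le.1 hlt
  have hp₀0 : 0 < (p₀ : ℝ) := by
    rw [hp₀, coe_criticalProbI]; exact criticalProb_zd_pos 3 (by norm_num)
  obtain ⟨δ, hδ, hδf⟩ := Metric.continuous_iff.1 hcont p₀ (ε - f p₀) (sub_pos.2 hlt')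
  set q : ℝ := max ((p₀ : ℝ) - δ / 2) ((p₀ : ℝ) / 2) with hq
  have hq0 : q < (p₀ : ℝ) := max_lt (by linarith) (by linarith)
  have hp₀1 : (p₀ : ℝ) ≤ 1 := p₀.2.2
  have hq01 : q ∈ unitInterval := ⟨le_trans (by linarith) (le_max_right _ _), by linarith⟩
  have hdist : dist (⟨q, hq01⟩ : unitInterval) p₀ < δ := by
    rw [Subtype.dist_eq, Real.dist_eq]
    show |q - (p₀ : ℝ)| < δ
    rw [abs_of_neg (sub_neg.2 hq0)]
    have : (p₀ : ℝ) - δ / 2 ≤ q := le_max_left _ _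
    linarith
  have hfq := hδf ⟨q, hq01⟩ hdist
  rw [Real.dist_eq] at hfq
  have hsmall : f ⟨q, hq01⟩ < ε := by linarith [(abs_lt.1 hfq).2]
  have hθ : 0 < theta (zdGraph 3) (0 : Site 3) ⟨q, hq01⟩ := hεn ⟨q, hq01⟩ n hn hsmall
  have hθ0 : theta (zdGraph 3) (0 : Site 3) ⟨q, hq01⟩ = 0 :=
    theta_eq_zero_of_lt_criticalProb_holds (zdGraph 3) (0 : Site 3) ⟨q, hq01⟩
      (by rw [coe_criticalProbI] at hq0; exact hq0)
  exact absurd hθ0 hθ.ne'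

/-- The VOID event: no vertex of `Λ_s` percolates. In a jump world its probability tends to `0` (ergodic
density), with NO rate available at `p_c` (the atom `OccRate` of the relay bootstrap). -/
def voidEvt (s : ℕ) : Set (BondConfig (Site 3)) := {ω | ∀ x ∈ box 3 s, ω ∉ percolatesAt x}

/-- A box all of whose vertices fail to reach `∂ⁱⁿΛ_R` inside `Λ_R` (`R ≥ s`) contains no percolating vertex
(first exit of an infinite open path; lattice configurations). [folklore] -/
theorem noCross_subset_voidEvt {s R : ℕ} (hsR : s ≤ R) {ω : BondConfig (Site 3)}
    (hω : ω ⊆ (zdGraph 3).edgeSet)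
    (h : ¬ ∃ x ∈ box 3 s, ∃ y ∈ innerBoundary (zdGraph 3) (box 3 R),
      ω ∈ openConnIn (↑(box 3 R) : Set (Site 3)) x y) : ω ∈ voidEvt s := by
  intro x hx hperc
  obtain ⟨y, hy, hxy⟩ := exists_openConnIn_innerBoundary_of_percolatesAt (box_mono 3 hsR hx) hω hperc
  exact h ⟨x, hx, y, hy, hxy⟩

/-- `⌊n/2⌋ ≤ 2 ⌈n^{7/6}⌉`. -/
theorem half_le_two_outer (n : ℕ) : n / 2 ≤ 2 * outer n := by
  have h1 : n ≤ outer n := le_nat_ceil_rpow (by norm_num : (1 : ℝ) ≤ 7 / 6) n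
  omega

/-- **CritPolyDichotomy in VOID currency**: at `p_c`, for all `n ≥ 2`,
`ε₀ ≤ L(n) · (P(voidEvt ⌊n/2⌋) + P(U's event at n))`.  In the `θ(p_c)=0` world the void term is `1` (no
content); in a jump world it says: U can hold with rate `o(n^{-1/6})` only if voids have frequency
`≳ n^{-1/6} / L(n)`-complement, i.e. any rate-`1/6⁺` proof of U certifies polynomially frequent `C_∞`-free boxes
of side `n` — the quantity no tool controls at `p_c` (relay-bootstrap atom `OccRate`). [folklore] -/
theorem critPolyDichotomy_voids (h : CritPolyDichotomy) : ∃ ε : ℝ, 0 < ε ∧ ∀ n : ℕ, 2 ≤ n →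
    ε ≤ (linkCount n : ℝ) *
      ((bondPercolation (zdGraph 3) (criticalProbI 3)).real (voidEvt (n / 2)) +
        (bondPercolation (zdGraph 3) (criticalProbI 3)).real
          {ω | ∃ x ∈ box 3 n, ∃ x' ∈ box 3 n,
            ∃ y ∈ innerBoundary (zdGraph 3) (box 3 (outer n)), ∃ y' ∈ innerBoundary (zdGraph 3) (box 3 (outer n)),
              ω ∈ openConnIn (↑(box 3 (outer n)) : Set (Site 3)) x y ∧
              ω ∈ openConnIn (↑(box 3 (outer n)) : Set (Site 3)) x' y' ∧
              ω ∉ openConnIn (↑(box 3 (outer n)) : Set (Site 3)) x x'}) := by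
  obtain ⟨ε, hε, hεn⟩ := h
  refine ⟨ε, hε, fun n hn => (hεn n hn).trans ?_⟩
  have hL : (0 : ℝ) ≤ (linkCount n : ℝ) := by positivity
  refine mul_le_mul_of_nonneg_left (add_le_add ?_ le_rfl) hL
  exact DCT16.real_mono_of_forall_subset_edgeSet (zdGraph 3) (criticalProbI 3)
    fun ω hω hmem => noCross_subset_voidEvt (half_le_two_outer n) hω hmem

end Summit.CriticalPhenomena.PercolationContinuityZ3.Cruxes.NearLinearTwoClusterDecay.StrategistR1

end
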